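import Literature.Computability.AlgebraicComplexity.DDS21TraceBackFinalStep
import Literature.RingTheory.MvPolynomial.DegreeOfTruncationBridges
import HarnessLib

/-!
# DDS 2021, proof of Thm. 3.2: the trace-back step (Claim 3.7) on the `mod z^D` calculus

Theorem-only file (cell `val-lit`, row X2-DDS21, brick B5 "trace back", the algebra of the step
`j + 1 ↦ j` of HOME/np/MEMO-t18g10-DDS21-B5-traceback.md §2 in frame (V)).
Source: P. Dutta, P. Dwivedi, N. Saxena, *Demystifying the border of depth-3 algebraic circuits*,
FOCS 2021 / full version [DuttaDwivediSaxena2022] (held text `paper:galaxy-pdf-7641649743695546420`),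
§3, proof of Thm. 3.2, Claim 3.7 ("Roadmap", p0034 L897 – p0035 L931): "The gist of the reduction
step is the identity (over `R_1(x)`): `f_1 = f_0' / t_2 − (t_2' / t_2²) · f_0` … hence
`f/t − f/t|_{z=0} ≡ ∑_{i≥1} (C_i/i) · z^i` (definite integration) … multiply by `t` and truncate";
and the detailed `k = 2` proof printed in P. Dutta, V. Lysikov, *Recent Advances in Debordering
Methods* (2025) [DuttaLysikov2025] (held `paper:arxiv-2510.13049`, §4.4.1).

Frame (agreed on the cell bus, lead-np CONSENT 2026-08-27 16:59Z): `z` is the variable `x_0` of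
`MvPolynomial (Fin (n+1)) F` (the `x_i` re-indexed by `Fin.succ`), "`≡ (mod z^D)`" is equality
after `Literature.RingTheory.MvPolynomial.truncDegreeOf 0 D` (file
`Literature/RingTheory/MvPolynomial/DegreeOfTruncation.lean`), "`|_{z=0}`" is `truncDegreeOf 0 1`,
`ε` never enters (the `ε → 0` limits are taken on the `ε`-side files and arrive here as
polynomials over `F`). Contents:

* §1 `z`-free multipliers (`degreeOf z c = 0`, e.g. `rename Fin.succ b`) commute with the
  `z`-degree slices and with termwise integration (with truncation: the tree's
  `truncDegreeOf_mul_of_degreeOf_eq_zero`, `DegreeOfTruncationBridges.lean`); they have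
  `∂_z c = 0`; cancellation of a nonzero `z`-free factor from a congruence.
* §2 the TRUNCATED INVERSE of a polynomial `w` with `z`-free part `b = w|_{z=0}`:
  `Inv_M := ∑_{j ≤ M} b^j (b − w)^{M−j}` with `w · Inv_M = b^{M+1} − (b − w)^{M+1} ≡ b^{M+1}
  (mod z^{M+1})` ("`1/(1 − z) ≡ 1 + … + z^{D−1}`", the inverse identity used throughout §3) and
  `Inv_M|_{z=0} = b^M`.
* §3 ★ the QUOTIENT-RULE TRACE-BACK (`truncDegreeOf_traceBack_step`; `truncDegreeOf_traceBack`
  is the same-modulus form): if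
  `∂_z P · w − P · ∂_z w ≡ w · H (mod z^M)` (the divide-and-derive identity `∂_z (P/w) = H/w`
  cleared of denominators), `w|_{z=0} = b ≠ 0` and `P|_{z=0} = p₀`, then
  `b^{M+1} · P ≡ w · (b^M · p₀ + ∫_M (H · Inv_M)) (mod z^{M+1})` — "integrate, add the `z = 0`
  value, multiply by `t`": exactly the pair `(Num, den) = (w · (…), b^{M+1})` that the last step
  `DDS2021.uabpComputes_of_phi_truncDegreeOf_eq` (`DDS21TraceBackFinalStep.lean`) consumes, with
  a `z`-FREE denominator (the "common `x`-denominator" form of the memo). This is the case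
  `v = val_z (t) = 0` of the printed step (the divisor's `z = 0` value is a nonzero polynomial in
  `x`); the case `v > 0` ("`d_{j+1} = d_j − v − 1`") is not treated here.
* §3b ABP PROGRAMS in the tree's currency `UABPComputes` (length-free `pow / neg / sub`; the
  truncated inverse `UABPComputes.truncInv`, budget `33 · s^3`; ★ `UABPComputes.traceBackNum`:
  programs for `w, b, p₀` within `s`, for `H` within `S`, `M + 1 ≤ s` ⇒ the numerator within
  `4 · S · s^2 + 145 · s^5`; `UABPComputes.traceBackDen`: `b^{M+1}` within `2 · s^2`) — "Size
  blowup" (p0036 L952–958) with explicit polynomials and no asymptotic constants.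
* §3c the step at `j = 0` END-TO-END with an `x`-denominator (`uabpComputes_of_traceBack_phi`):
  for `P = Φ_α(f)` (`truncDegreeOf_one_aeval_phi`: `Φ_α(f)|_{z=0} = C (f(α))`) and
  `w|_{z=0} = rename Fin.succ b'`, `b' ∈ F[x] ∖ {0}`, §3 + §3b feed the last step
  `uabpComputes_of_phi_truncDegreeOf_eq` (division elimination, `Φ^{-1}`):
  `UABPComputes (100 · s'^5) f` for `s' ≥ 4·S·s^4 + 145·s^7 + 2`.

* §5 the GENERAL ROUND (`j ≥ 1`; `truncDegreeOf_traceBack_round`): `f_j = P/E` carried as a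
  VIRTUAL fraction (no program for `P`, `E`), the divisor as a fraction `A/B` with `z`-free nonzero
  `z = 0` values (case `v = 0`), the `z = 0` value of `f_j/t_j` as a cross-multiplied pair
  `ew · (P B)|_{z=0} = Nw · (E A)|_{z=0}` (Claim 3.8's export), and the next stage's congruence
  `den′ · N′ ≡ Num′ · E′ (mod z^M)` for `N′/E′ = ∂_z((P B)/(E A))` ⟹
  `(β^{M+1} b^{M+1} den′ ew) · P ≡ (A · R · Inv_M(B)) · E (mod z^{M+1})`; the first-round
  conversion `truncDegreeOf_traceBack_top` ("`f_{k−1}` is ABP/ABP" ⇒ `z`-free denominator); programs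
  `UABPComputes.traceBackCore / traceBackRoundNum / traceBackRoundDen`. With §5 the trace-back
  of Thm. 3.2 is a `k`-fold iteration over a transcript of such data (assembly not in this file).

What this is NOT: the `k = 2` assembly (`AC/DDS21TopFaninTwoTraceBack.lean`, val-lit-p2, which
may instantiate §3 at `b = C κ`, `p₀ = C (f(α))`, where no division elimination is needed) and
the DiDIL step producing the identity (bricks B4a–c) are separate files; `DDS2021_thm_3_2` (all
`k`) stays OPEN by name.

0 definitions, 0 named facts. Honest framing: ABP-side bookkeeping of a published 2021 proof;
nothing here bears on VP versus VNP, which is NOT proved.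
-/

open MvPolynomial
open Literature.RingTheory.MvPolynomial

open scoped BigOperators

namespace Literature.Computability.AlgebraicComplexity

namespace DDS2021

/-! ## §1 `z`-free multipliers and the `z = 0` slice -/

section ZFree

variable {σ : Type*} {R : Type*} [CommSemiring R] [DecidableEq σ]

omit [DecidableEq σ] in
/-- A `z`-free polynomial (`deg_z c = 0`) has `∂_z c = 0` (the `x`-denominators `den_j ∈ F[x]` of
the trace-back are constants for `∂_z`). [cite: DuttaDwivediSaxena2022, §3 proof of Thm. 3.2, Claim 3.7 (full version p0034 L906–912)] -/
theorem pderiv_eq_zero_of_degreeOf_eq_zero {i : σ} {c : MvPolynomial σ R} (hc : c.degreeOf i = 0) :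
    pderiv i c = 0 :=
  pderiv_eq_zero_of_notMem_vars (by rw [mem_vars_iff_degreeOf_ne_zero]; exact fun h => h hc)

/-- A `z`-free polynomial is its own residue modulo `z^D`, `D ≥ 1`.
[cite: DuttaDwivediSaxena2022, §3 proof of Thm. 3.2 (full version p0028 L755–757)] -/
theorem truncDegreeOf_eq_self_of_degreeOf_eq_zero {i : σ} {c : MvPolynomial σ R}
    (hc : c.degreeOf i = 0) {D : ℕ} (hD : 0 < D) : truncDegreeOf i D c = c :=
  truncDegreeOf_eq_self (by rw [hc]; exact hD)

/-- The `z = 0` slice `T_1 p` is `z`-free. [cite: DuttaDwivediSaxena2022, §3 proof of Thm. 3.2, Claim 3.7 (full version p0035 L923 "`f/t|_{z=0}`")] -/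
theorem degreeOf_truncDegreeOf_one (i : σ) (p : MvPolynomial σ R) :
    (truncDegreeOf i 1 p).degreeOf i = 0 := by
  have h := degreeOf_truncDegreeOf_lt (i := i) Nat.one_pos p
  omega

omit [DecidableEq σ] in
/-- Powers of a `z`-free polynomial are `z`-free. [folklore] -/
private theorem degreeOf_pow_eq_zero {i : σ} {c : MvPolynomial σ R} (hc : c.degreeOf i = 0) (e : ℕ) :
    (c ^ e).degreeOf i = 0 := by
  have h := degreeOf_pow_le i c e
  rw [hc, mul_zero] at h
  exact Nat.le_zero.1 h

/-- Slicing off one more `z`-degree: `T_{k+1} p = T_k p + p^{(z)}_k`. [cite: DuttaDwivediSaxena2022, §3 proof of Thm. 3.2, Claim 3.7 (full version p0034 L910–913 "`f_1 = ∑ C_i z^i`")] -/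
theorem truncDegreeOf_succ_eq_add (i : σ) (k : ℕ) (p : MvPolynomial σ R) :
    truncDegreeOf i (k + 1) p =
      truncDegreeOf i k p + weightedHomogeneousComponent (Pi.single i 1) k p := by
  rw [truncDegreeOf_apply, truncDegreeOf_apply, Finset.sum_range_succ]

/-- A polynomial all of whose monomials have `z`-degree `≥ 1` has `N`-th power `≡ 0 (mod z^N)`
(valuations add). [cite: DuttaDwivediSaxena2022, §3 proof of Thm. 3.2 (full version p0035 L926–928; p0038 L1016 "valuation")] -/
theorem truncDegreeOf_pow_eq_zero_of_le_valuation {i : σ} {r : MvPolynomial σ R}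
    (hr : ∀ d ∈ r.support, 1 ≤ d i) : ∀ N : ℕ, truncDegreeOf i N (r ^ N) = 0 := by
  intro N
  induction N with
  | zero => rw [truncDegreeOf_zero_right]
  | succ N ih =>
    have h := truncDegreeOf_mul_congr_of_le (i := i) (a := N) (v := 1) (r := r) (p := r ^ N)
      (q := 0) (by rw [ih, map_zero]) hr
    rw [mul_zero, map_zero, ← pow_succ'] at h
    exact h

/-- The same modulo any smaller power: `T_D (r^N) = 0` for `D ≤ N`.
[cite: DuttaDwivediSaxena2022, §3 proof of Thm. 3.2 (full version p0035 L926–928)] -/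
theorem truncDegreeOf_pow_eq_zero_of_le_valuation_of_le {i : σ} {r : MvPolynomial σ R}
    (hr : ∀ d ∈ r.support, 1 ≤ d i) {D N : ℕ} (hDN : D ≤ N) : truncDegreeOf i D (r ^ N) = 0 := by
  have h := truncDegreeOf_congr_mono (i := i) (p := r ^ N) (q := 0) hDN
    (by rw [truncDegreeOf_pow_eq_zero_of_le_valuation hr N, map_zero])
  rw [h, map_zero]

variable {S : Type*} [CommRing S]

/-- The `z`-degree slices commute with `z`-free multipliers (`(c p)_k = c · p_k`).
[cite: DuttaDwivediSaxena2022, §3 proof of Thm. 3.2, Claim 3.7 (full version p0034 L910–913)] -/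
theorem weightedHomogeneousComponent_mul_left_of_degreeOf_eq_zero {i : σ} {c : MvPolynomial σ S}
    (hc : c.degreeOf i = 0) (k : ℕ) (p : MvPolynomial σ S) :
    weightedHomogeneousComponent (Pi.single i 1) k (c * p) =
      c * weightedHomogeneousComponent (Pi.single i 1) k p := by
  have h1 := truncDegreeOf_succ_eq_add i k (c * p)
  rw [truncDegreeOf_mul_of_degreeOf_eq_zero hc, truncDegreeOf_mul_of_degreeOf_eq_zero hc,
    truncDegreeOf_succ_eq_add, mul_add] at h1
  exact (add_left_cancel h1).symm

/-- `b − w` has all monomials of `z`-degree `≥ 1` when `b = w|_{z=0}` ("`T = z^v · (unit)`": the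
`z`-adic expansion of a denominator around its `z = 0` value).
[cite: DuttaDwivediSaxena2022, §3 proof of Thm. 3.2, Claim 3.7 (full version p0034 L906–909)] -/
theorem one_le_of_mem_support_truncDegreeOf_one_sub {i : σ} {w b : MvPolynomial σ S}
    (hb : truncDegreeOf i 1 w = b) : ∀ d ∈ (b - w).support, 1 ≤ d i := by
  intro d hd
  rw [mem_support_iff, coeff_sub, ← hb, coeff_truncDegreeOf] at hd
  by_contra h
  have h0 : d i < 1 := by omega
  rw [if_pos h0, sub_self] at hd
  exact hd rfl

/-- **Cancellation of a nonzero `z`-free factor from a congruence** (over a domain):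
`c · p ≡ c · q (mod z^D)`, `deg_z c = 0`, `c ≠ 0` ⇒ `p ≡ q (mod z^D)`.
[cite: DuttaDwivediSaxena2022, §3 proof of Thm. 3.2, Claim 3.7 (full version p0035 L923–931)] -/
theorem truncDegreeOf_cancel_left [IsDomain S] {i : σ} {c p q : MvPolynomial σ S}
    (hc : c.degreeOf i = 0) (hc0 : c ≠ 0) {D : ℕ}
    (h : truncDegreeOf i D (c * p) = truncDegreeOf i D (c * q)) :
    truncDegreeOf i D p = truncDegreeOf i D q := by
  rw [truncDegreeOf_mul_of_degreeOf_eq_zero hc, truncDegreeOf_mul_of_degreeOf_eq_zero hc]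
    at h
  exact mul_left_cancel₀ hc0 h

variable {K : Type*} [Field K]

/-- Termwise integration in `z` is linear over `z`-free multipliers: `∫_D (c p) = c · ∫_D p`.
[cite: DuttaDwivediSaxena2022, §3 proof of Thm. 3.2, Claim 3.7 (full version p0034 L913–914, p0035 L923)] -/
theorem integrateDegreeOf_mul_left_of_degreeOf_eq_zero {i : σ} {c : MvPolynomial σ K}
    (hc : c.degreeOf i = 0) (D : ℕ) (p : MvPolynomial σ K) :
    integrateDegreeOf i D (c * p) = c * integrateDegreeOf i D p := by
  unfold integrateDegreeOf
  rw [Finset.mul_sum]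
  refine Finset.sum_congr rfl fun k _ => ?_
  rw [weightedHomogeneousComponent_mul_left_of_degreeOf_eq_zero hc]
  ring

end ZFree

/-! ## §2 The truncated inverse of a polynomial with `z`-free, nonzero value at `z = 0` -/

section Inverse

variable {σ : Type*} {S : Type*} [CommRing S] [DecidableEq σ]

omit [DecidableEq σ] in
/-- **The truncated inverse identity**: for `Inv_M := ∑_{j ≤ M} b^j (b − w)^{M−j}` one has
`w · Inv_M = b^{M+1} − (b − w)^{M+1}` (telescoping; "`1/(1 − z) ≡ 1 + z + … + z^{D−1} mod z^D`").
[cite: DuttaDwivediSaxena2022, §3 proof of Thm. 3.2, Claim 3.7 (full version p0034 L906–913) and Lemma 2.6 (p0018 L493–495)] -/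
theorem mul_truncInv_eq (w b : MvPolynomial σ S) (M : ℕ) :
    w * (∑ j ∈ Finset.range (M + 1), b ^ j * (b - w) ^ (M - j)) =
      b ^ (M + 1) - (b - w) ^ (M + 1) := by
  have h := geom_sum₂_mul b (b - w) (M + 1)
  simp only [Nat.add_sub_cancel, sub_sub_cancel] at h
  rw [mul_comm]
  exact h

/-- **`w · Inv_M ≡ b^{M+1} (mod z^{M+1})`** when `b = w|_{z=0}` (the error term `(b − w)^{M+1}`
has `z`-valuation `≥ M+1`). [cite: DuttaDwivediSaxena2022, §3 proof of Thm. 3.2, Claim 3.7 (full version p0034 L906–913)] -/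
theorem truncDegreeOf_mul_truncInv {i : σ} {w b : MvPolynomial σ S} (hb : truncDegreeOf i 1 w = b)
    (M : ℕ) :
    truncDegreeOf i (M + 1) (w * ∑ j ∈ Finset.range (M + 1), b ^ j * (b - w) ^ (M - j)) =
      truncDegreeOf i (M + 1) (b ^ (M + 1)) := by
  rw [mul_truncInv_eq, map_sub,
    truncDegreeOf_pow_eq_zero_of_le_valuation (one_le_of_mem_support_truncDegreeOf_one_sub hb)
      (M + 1), sub_zero]

/-- The same with the `z`-free right-hand side made explicit: `T_{M+1} (w · Inv_M) = b^{M+1}`.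
[cite: DuttaDwivediSaxena2022, §3 proof of Thm. 3.2, Claim 3.7 (full version p0034 L906–913)] -/
theorem truncDegreeOf_mul_truncInv_eq_pow {i : σ} {w b : MvPolynomial σ S}
    (hb : truncDegreeOf i 1 w = b) (M : ℕ) :
    truncDegreeOf i (M + 1) (w * ∑ j ∈ Finset.range (M + 1), b ^ j * (b - w) ^ (M - j)) =
      b ^ (M + 1) := by
  rw [truncDegreeOf_mul_truncInv hb]
  have hbz : b.degreeOf i = 0 := by rw [← hb]; exact degreeOf_truncDegreeOf_one i w
  exact truncDegreeOf_eq_self_of_degreeOf_eq_zero (degreeOf_pow_eq_zero hbz _) (Nat.succ_pos M)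

/-- **The `z = 0` value of the truncated inverse**: `Inv_M|_{z=0} = b^M` (only the term `j = M`
survives). [cite: DuttaDwivediSaxena2022, §3 proof of Thm. 3.2, Claim 3.7 (full version p0034 L906–913, p0035 L923)] -/
theorem truncDegreeOf_one_truncInv {i : σ} {w b : MvPolynomial σ S} (hb : truncDegreeOf i 1 w = b)
    (M : ℕ) :
    truncDegreeOf i 1 (∑ j ∈ Finset.range (M + 1), b ^ j * (b - w) ^ (M - j)) = b ^ M := by
  have hbz : b.degreeOf i = 0 := by rw [← hb]; exact degreeOf_truncDegreeOf_one i w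
  rw [map_sum, Finset.sum_eq_single_of_mem M (Finset.mem_range.2 (Nat.lt_succ_self M))]
  · rw [Nat.sub_self, pow_zero, mul_one]
    exact truncDegreeOf_eq_self_of_degreeOf_eq_zero (degreeOf_pow_eq_zero hbz _) Nat.one_pos
  · intro j hj hjM
    rw [Finset.mem_range] at hj
    rw [truncDegreeOf_mul_of_degreeOf_eq_zero (degreeOf_pow_eq_zero hbz _),
      truncDegreeOf_pow_eq_zero_of_le_valuation_of_le
        (one_le_of_mem_support_truncDegreeOf_one_sub hb) (show 1 ≤ M - j from by omega),
      mul_zero]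

end Inverse

/-! ## §3 The quotient-rule trace-back step (Claim 3.7), cancellation-free on representatives -/

section TraceBack

variable {σ : Type*} {K : Type*} [Field K] [CharZero K] [DecidableEq σ]

/-- **DDS Claim 3.7, one trace-back step, PROVED as `mod z^D` algebra** (differentiation loses one
order, integration regains it: hypothesis `mod z^M`, conclusion `mod z^{M+1}` — "`d_1 := d_0 − 1`",
"after differentiation it must hold mod `z^{d_0 − v_{k,0} − 1}`"). Let
`Inv_M := ∑_{j ≤ M} b^j (b − w)^{M−j}` be the truncated inverse of `w` around its `z = 0` value
`b = w|_{z=0} ≠ 0`. If the divide-and-derive identity holds in the cleared form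
`∂_z P · w − P · ∂_z w ≡ w · H (mod z^M)` (i.e. "`∂_z (P/w) = H/w`", the shape in which the
`ε`-side delivers `f_{j+1} = ∂_z (f_j / t)`), and `P|_{z=0} = p₀`, then
`b^{M+1} · P ≡ w · (b^M · p₀ + ∫_M (H · Inv_M)) (mod z^{M+1})` — "`f/t = f/t|_{z=0} +
∑_{i≥1} (C_i/i) z^i` … Thus, multiply `t` and truncate". The right-hand side is a POLYNOMIAL
assembled from `w, H, p₀, b` by ring operations and termwise integration (so it inherits ABP
programs from them), and the left multiplier `b^{M+1}` is `z`-free: this is the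
pair `(Num, den)` of the last step `uabpComputes_of_phi_truncDegreeOf_eq`.
[cite: DuttaDwivediSaxena2022, §3 proof of Thm. 3.2, Claim 3.7 (full version p0029 L779–782, p0034 L897 – p0035 L931)] -/
theorem truncDegreeOf_traceBack_step {i : σ} {M : ℕ} {P w H b p₀ : MvPolynomial σ K}
    (hWM : truncDegreeOf i M (pderiv i P * w - P * pderiv i w) = truncDegreeOf i M (w * H))
    (hb : truncDegreeOf i 1 w = b) (hb0 : b ≠ 0) (hP0 : truncDegreeOf i 1 P = p₀) :
    truncDegreeOf i (M + 1) (b ^ (M + 1) * P) =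
      truncDegreeOf i (M + 1) (w * (b ^ M * p₀ +
        integrateDegreeOf i M (H * ∑ j ∈ Finset.range (M + 1), b ^ j * (b - w) ^ (M - j)))) := by
  set Inv : MvPolynomial σ K := ∑ j ∈ Finset.range (M + 1), b ^ j * (b - w) ^ (M - j) with hInv_def
  set B : MvPolynomial σ K := b ^ (M + 1) with hB_def
  have hbz : b.degreeOf i = 0 := by rw [← hb]; exact degreeOf_truncDegreeOf_one i w
  have hBz : B.degreeOf i = 0 := degreeOf_pow_eq_zero hbz _
  have hB0 : B ≠ 0 := pow_ne_zero _ hb0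
  -- (1) `w · Inv ≡ B (mod z^{M+1})`, hence also `(mod z^M)`
  have h1 : truncDegreeOf i (M + 1) (w * Inv) = truncDegreeOf i (M + 1) B :=
    truncDegreeOf_mul_truncInv hb M
  have h1M : truncDegreeOf i M (w * Inv) = truncDegreeOf i M B :=
    truncDegreeOf_congr_mono (Nat.le_succ M) h1
  -- (2) differentiate (1): `∂w · Inv + w · ∂Inv ≡ 0 (mod z^M)` (`∂B = 0`)
  have h2 : truncDegreeOf i M (w * pderiv i Inv) = truncDegreeOf i M (-(pderiv i w * Inv)) := by
    have h := truncDegreeOf_pderiv_congr h1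
    rw [pderiv_mul, pderiv_eq_zero_of_degreeOf_eq_zero hBz, map_zero, map_add] at h
    have h' := eq_neg_of_add_eq_zero_right h
    rw [← map_neg] at h'
    exact h'
  -- (3) the quotient rule: `B · ∂(P · Inv) ≡ B · (H · Inv) (mod z^M)`
  have h4 : truncDegreeOf i M (B * pderiv i (P * Inv)) = truncDegreeOf i M (B * (H * Inv)) := by
    have e1 : B * pderiv i (P * Inv) = pderiv i (P * Inv) * B := mul_comm _ _
    have s1 : truncDegreeOf i M (pderiv i (P * Inv) * B) =
        truncDegreeOf i M (pderiv i (P * Inv) * (w * Inv)) := truncDegreeOf_mul_congr rfl h1M.symm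
    have e2 : pderiv i (P * Inv) * (w * Inv) =
        Inv * Inv * (pderiv i P * w) + Inv * P * (w * pderiv i Inv) := by
      rw [pderiv_mul]; ring
    have s2 : truncDegreeOf i M (Inv * P * (w * pderiv i Inv)) =
        truncDegreeOf i M (Inv * P * (-(pderiv i w * Inv))) := truncDegreeOf_mul_congr rfl h2
    have e3 : Inv * Inv * (pderiv i P * w) + Inv * P * (-(pderiv i w * Inv)) =
        Inv * Inv * (pderiv i P * w - P * pderiv i w) := by ring
    have s3 : truncDegreeOf i M (Inv * Inv * (pderiv i P * w - P * pderiv i w)) =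
        truncDegreeOf i M (Inv * Inv * (w * H)) := truncDegreeOf_mul_congr rfl hWM
    have e4 : Inv * Inv * (w * H) = (w * Inv) * (H * Inv) := by ring
    have s4 : truncDegreeOf i M ((w * Inv) * (H * Inv)) = truncDegreeOf i M (B * (H * Inv)) :=
      truncDegreeOf_mul_congr h1M rfl
    rw [e1, s1, e2, map_add, s2, ← map_add, e3, s3, e4, s4]
  -- (4) `B · ∂(P Inv) = ∂(B · P · Inv)`; integrate (fundamental theorem mod `z^{M+1}`)
  have h5 : truncDegreeOf i M (pderiv i (B * (P * Inv))) = truncDegreeOf i M (B * (H * Inv)) := by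
    rw [pderiv_mul, pderiv_eq_zero_of_degreeOf_eq_zero hBz, zero_mul, zero_add]
    exact h4
  have h6 := truncDegreeOf_succ_eq_of_pderiv_congr h5
  -- (5) the `z = 0` value: `(B P Inv)|_{z=0} = B · p₀ · b^M`
  have h7 : weightedHomogeneousComponent (Pi.single i 1) 0 (B * (P * Inv)) = B * (p₀ * b ^ M) := by
    rw [← truncDegreeOf_one, truncDegreeOf_one_mul,
      truncDegreeOf_one_mul, truncDegreeOf_eq_self_of_degreeOf_eq_zero hBz Nat.one_pos, hP0,
      hInv_def, truncDegreeOf_one_truncInv hb M]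
  rw [h7, integrateDegreeOf_mul_left_of_degreeOf_eq_zero hBz, ← mul_add] at h6
  have h6' : truncDegreeOf i (M + 1) (B * (P * Inv)) =
      truncDegreeOf i (M + 1) (B * (p₀ * b ^ M + integrateDegreeOf i M (H * Inv))) := by
    rw [← h6, truncDegreeOf_truncDegreeOf, min_self]
  -- (6) multiply by `w` and use (1) on the left: `w · B · P · Inv ≡ B · B · P`
  have h8 : truncDegreeOf i (M + 1) (w * (B * (P * Inv))) =
      truncDegreeOf i (M + 1) (w * (B * (p₀ * b ^ M + integrateDegreeOf i M (H * Inv)))) :=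
    truncDegreeOf_mul_congr rfl h6'
  have e5 : w * (B * (P * Inv)) = B * P * (w * Inv) := by ring
  have s5 : truncDegreeOf i (M + 1) (B * P * (w * Inv)) = truncDegreeOf i (M + 1) (B * P * B) :=
    truncDegreeOf_mul_congr rfl h1
  have e6 : B * P * B = B * (B * P) := by ring
  have e7 : w * (B * (p₀ * b ^ M + integrateDegreeOf i M (H * Inv))) =
      B * (w * (b ^ M * p₀ + integrateDegreeOf i M (H * Inv))) := by ring
  rw [e5, s5, e6, e7] at h8
  -- (7) cancel the nonzero `z`-free factor `B`
  exact truncDegreeOf_cancel_left hBz hB0 h8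

/-- The same with the hypothesis at the modulus of the conclusion (`mod z^{M+1}` throughout; only
its reduction `mod z^M` is used). [cite: DuttaDwivediSaxena2022, §3 proof of Thm. 3.2, Claim 3.7 (full version p0034 L897 – p0035 L931)] -/
theorem truncDegreeOf_traceBack {i : σ} {M : ℕ} {P w H b p₀ : MvPolynomial σ K}
    (hW : truncDegreeOf i (M + 1) (pderiv i P * w - P * pderiv i w) =
      truncDegreeOf i (M + 1) (w * H))
    (hb : truncDegreeOf i 1 w = b) (hb0 : b ≠ 0) (hP0 : truncDegreeOf i 1 P = p₀) :
    truncDegreeOf i (M + 1) (b ^ (M + 1) * P) =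
      truncDegreeOf i (M + 1) (w * (b ^ M * p₀ +
        integrateDegreeOf i M (H * ∑ j ∈ Finset.range (M + 1), b ^ j * (b - w) ^ (M - j)))) :=
  truncDegreeOf_traceBack_step (truncDegreeOf_congr_mono (Nat.le_succ M) hW) hb hb0 hP0

end TraceBack

/-! ## §3b ABP programs for the trace-back data (budgets in the tree's `UABPComputes`) -/

section LengthFree

variable {F : Type*} [CommSemiring F] {m : ℕ}

/-- Powers on `UABPComputes` (iterated series composition; budget `2 + e · S`).
[cite: DuttaDwivediSaxena2022, §2.1 remark after Def. 2.5 (full version p0018 L477–478)] -/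
theorem UABPComputes.pow {S : ℕ} {f : MvPolynomial (Fin m) F} (hf : UABPComputes S f) (e : ℕ) :
    UABPComputes (2 + e * S) (f ^ e) := by
  obtain ⟨L, hf⟩ := hf.exists_len
  exact (hf.pow e).uabpComputes

variable {R : Type*} [CommRing R]

/-- Negation on `UABPComputes` (budget `S + 2`). [cite: DuttaDwivediSaxena2022, §2.1 remark after Def. 2.5 (full version p0018 L477–478)] -/
theorem UABPComputes.neg {S : ℕ} {f : MvPolynomial (Fin m) R} (hf : UABPComputes S f) :
    UABPComputes (S + 2) (-f) := by
  have h := hf.smul_C (-1)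
  rwa [C_neg, C_1, neg_one_mul] at h

/-- Subtraction on `UABPComputes` (budget `4 · (S₁ + (S₂ + 2)) + 2`).
[cite: DuttaDwivediSaxena2022, §2.1 remark after Def. 2.5 (full version p0018 L477–478)] -/
theorem UABPComputes.sub {S₁ S₂ : ℕ} {f g : MvPolynomial (Fin m) R} (hf : UABPComputes S₁ f)
    (hg : UABPComputes S₂ g) : UABPComputes (4 * (S₁ + (S₂ + 2)) + 2) (f - g) := by
  rw [sub_eq_add_neg]
  exact hf.add hg.neg

end LengthFree

section Programs

variable {K : Type*} [Field K] {m : ℕ}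

/-- **An ABP for the truncated inverse** `Inv_M = ∑_{j ≤ M} b^j (b − w)^{M−j}`: if `w` and `b`
have programs within budget `s ≥ max(M + 1, 2)`, then `Inv_M` has one within budget `33 · s^3`
("the inverse identity … the size of the ABPs does not increase" — here with explicit polynomial
bookkeeping). [cite: DuttaDwivediSaxena2022, §3 proof of Thm. 3.2, Claim 3.7 (full version p0034 L906–913)] -/
theorem UABPComputes.truncInv {s M : ℕ} {w b : MvPolynomial (Fin m) K} (hw : UABPComputes s w)
    (hb : UABPComputes s b) (hM : M + 1 ≤ s) (hs : 2 ≤ s) :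
    UABPComputes (33 * s ^ 3) (∑ j ∈ Finset.range (M + 1), b ^ j * (b - w) ^ (M - j)) := by
  classical
  have hbw : UABPComputes (4 * (s + (s + 2)) + 2) (b - w) := hb.sub hw
  have hterm : ∀ j : Fin (M + 1),
      UABPComputes (16 * s ^ 2) (b ^ (j : ℕ) * (b - w) ^ (M - (j : ℕ))) := by
    intro j
    refine ((hb.pow (j : ℕ)).mul (hbw.pow (M - (j : ℕ)))).mono ?_
    have hj : (j : ℕ) ≤ s := by have := j.isLt; omega
    have hMj : M - (j : ℕ) ≤ s := by omega
    have e1 : (j : ℕ) * s ≤ s * s := Nat.mul_le_mul_right s hj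
    have e2 : (M - (j : ℕ)) * (4 * (s + (s + 2)) + 2) ≤ 8 * (s * s) + 10 * s :=
      le_trans (Nat.mul_le_mul hMj (show 4 * (s + (s + 2)) + 2 ≤ 8 * s + 10 from by omega))
        (le_of_eq (by ring))
    have e3 : 10 * s + 4 ≤ 7 * (s * s) := by nlinarith
    rw [sq]
    omega
  rw [Finset.sum_range]
  refine (UABPComputes.sum (S := 16 * s ^ 2) (by nlinarith) _ hterm).mono ?_
  rw [Fintype.card_fin]
  have e4 : (M + 1) * (16 * s ^ 2 + 16 * s ^ 2) ≤ s * (16 * s ^ 2 + 16 * s ^ 2) :=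
    Nat.mul_le_mul_right _ hM
  have e5 : s * (16 * s ^ 2 + 16 * s ^ 2) = 32 * s ^ 3 := by ring
  have e6 : 2 ≤ s ^ 3 := le_trans hs (Nat.le_self_pow (by norm_num) s)
  omega

/-- **An ABP for the trace-back numerator** `Num = w · (b^M · p₀ + ∫_M (H · Inv_M))` of
`truncDegreeOf_traceBack` ("each ABP/ABP [coefficient] … integrate … multiply by `t` and
truncate": the sizes stay polynomial): with programs for `w, b, p₀` within budget `s` and for `H`
within budget `S`, `M + 1 ≤ s`, `2 ≤ s`, the numerator has a program within budget
`4 · S · s^2 + 145 · s^5`, and the denominator `b^{M+1}` one within `2 · s^2`.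
[cite: DuttaDwivediSaxena2022, §3 proof of Thm. 3.2, Claim 3.7 and "Size blowup" (full version p0035 L923–931, p0036 L952–958)] -/
theorem UABPComputes.traceBackNum (i : Fin m) {s S M : ℕ} {w H p₀ b : MvPolynomial (Fin m) K}
    (hw : UABPComputes s w) (hH : UABPComputes S H) (hp : UABPComputes s p₀)
    (hb : UABPComputes s b) (hM : M + 1 ≤ s) (hs : 2 ≤ s) :
    UABPComputes (4 * S * s ^ 2 + 145 * s ^ 5)
      (w * (b ^ M * p₀ + Literature.RingTheory.MvPolynomial.integrateDegreeOf i M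
        (H * ∑ j ∈ Finset.range (M + 1), b ^ j * (b - w) ^ (M - j)))) := by
  have hInv := UABPComputes.truncInv hw hb hM hs
  have h1 := ((hH.mul hInv).integrateDegreeOf i M)
  have h2 : UABPComputes (2 + M * s + s) (b ^ M * p₀) := (hb.pow M).mul hp
  refine (hw.mul (h2.add h1)).mono ?_
  have hMs : M ≤ s := by omega
  have e1 : M * s ≤ s * s := Nat.mul_le_mul_right s hMs
  have e2 : M * (2 + (S + 33 * s ^ 3) * M) ≤ s * (2 + (S + 33 * s ^ 3) * s) :=
    Nat.mul_le_mul hMs (Nat.add_le_add_left (Nat.mul_le_mul_left _ hMs) 2)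
  have e3 : s * (2 + (S + 33 * s ^ 3) * s) = 2 * s + S * (s * s) + 33 * s ^ 5 := by ring
  have e4 : 4 * S * s ^ 2 = 4 * (S * (s * s)) := by ring
  have e5 : 4 * (s * s) + 13 * s + 18 ≤ 13 * s ^ 5 := by
    have h4 : 4 ≤ s * s := Nat.mul_le_mul hs hs
    have h8 : 2 * (s * s) ≤ s * s * s := by nlinarith
    have h16 : 16 * s ≤ s ^ 5 := by
      calc 16 * s = 4 * 4 * s := by ring
        _ ≤ (s * s) * (s * s) * s := Nat.mul_le_mul_right s (Nat.mul_le_mul h4 h4)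
        _ = s ^ 5 := by ring
    nlinarith
  omega

/-- The denominator `b^{M+1}` of the trace-back step has a program within budget `2 · s^2`.
[cite: DuttaDwivediSaxena2022, §3 proof of Thm. 3.2, Claim 3.7 and "Size blowup" (full version p0035 L930–931, p0036 L952–958)] -/
theorem UABPComputes.traceBackDen {s M : ℕ} {b : MvPolynomial (Fin m) K} (hb : UABPComputes s b)
    (hM : M + 1 ≤ s) (hs : 2 ≤ s) : UABPComputes (2 * s ^ 2) (b ^ (M + 1)) := by
  refine (hb.pow (M + 1)).mono ?_
  have e1 : (M + 1) * s ≤ s * s := Nat.mul_le_mul_right s hM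
  have e2 : 2 ≤ s * s := le_trans hs (Nat.le_mul_of_pos_right s (by omega))
  rw [sq]
  omega

end Programs

/-! ## §3c End-to-end at `j = 0`: from a divide-and-derive identity for `Φ_α(f)` with an
`x`-denominator to an ABP for `f` (§3 + the last step `uabpComputes_of_phi_truncDegreeOf_eq`) -/

section PhiStep

variable {F : Type*} [Field F] {n : ℕ}

/-- **`Φ_α(f)|_{z=0} = f(α)`**: the `z = 0` value of `Φ_α(f) = f(z x + α)` is the constant `f(α)`
("`Φ(T_{i,0})|_{z=0} ∈ F(ε)`": at `z = 0` every `Φ(ℓ) = ℓ(α) + z·(…)` collapses to its value at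
`α`). [cite: DuttaDwivediSaxena2022, §3 proof of Thm. 3.2 (full version p0028 L751–760)] -/
theorem truncDegreeOf_one_aeval_phi (f : MvPolynomial (Fin n) F) (α : Fin n → F) :
    truncDegreeOf 0 1
        (aeval (fun i : Fin n => (X 0 * X i.succ + C (α i) : MvPolynomial (Fin (n + 1)) F)) f) =
      C (eval α f) := by
  classical
  induction f using MvPolynomial.induction_on with
  | C a =>
    rw [aeval_C, eval_C, algebraMap_eq]
    exact truncDegreeOf_eq_self (by rw [degreeOf_C]; exact Nat.one_pos)
  | add p q hp hq => rw [map_add, map_add, hp, hq, map_add, map_add]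
  | mul_X p j hp =>
    rw [map_mul, aeval_X, truncDegreeOf_one_mul, hp, map_mul, eval_X, map_mul, map_add,
      truncDegreeOf_eq_self (i := (0 : Fin (n + 1))) (p := C (α j))
        (by rw [degreeOf_C]; exact Nat.one_pos)]
    have h0 : truncDegreeOf 0 1 (X 0 * X j.succ : MvPolynomial (Fin (n + 1)) F) = 0 := by
      have h := truncDegreeOf_X_pow_mul (R := F) (0 : Fin (n + 1)) 0 1 (X j.succ)
      rw [pow_one, Nat.zero_add, truncDegreeOf_zero_right, mul_zero] at h
      exact h
    rw [h0, zero_add]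

variable [CharZero F]

/-- **The trace-back at `j = 0`, END-TO-END with an `x`-denominator.** If `Φ_α(f)` satisfies a
divide-and-derive identity `∂_z Φ(f) · w − Φ(f) · ∂_z w ≡ w · H (mod z^M)` with
`deg f ≤ M`, the divisor's `z = 0` value being a NONZERO POLYNOMIAL IN `x`
(`w|_{z=0} = b'(x_1, …, x_n)`), and `w, b', H` have ABPs (budgets `s, s, S`, `M + 1 ≤ s`,
`2 ≤ s`), then `f` has an ABP within budget `100 · s'^5` for every
`s' ≥ 4·S·s^4 + 145·s^7 + 2`: §3 gives `b'^{M+1} · Φ(f) ≡ Num (mod z^{M+1})` with the common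
`x`-denominator `den = b'^{M+1}`, and the last step ("eliminate the division … apply `Φ^{-1}`",
`uabpComputes_of_phi_truncDegreeOf_eq`) finishes. (At `k = 2` the denominator is a constant and
no division elimination is needed — that assembly is the separate file
`DDS21TopFaninTwoTraceBack.lean`.)
[cite: DuttaDwivediSaxena2022, §3 proof of Thm. 3.2, Claim 3.7 and "Size blowup" (full version p0034 L897 – p0035 L931, p0036 L952–961)] -/
theorem uabpComputes_of_traceBack_phi {M s S s' : ℕ} (f : MvPolynomial (Fin n) F) (α : Fin n → F)
    {w H : MvPolynomial (Fin (n + 1)) F} {b' : MvPolynomial (Fin n) F}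
    (hW : truncDegreeOf 0 M
        (pderiv 0 (aeval (fun i : Fin n =>
            (X 0 * X i.succ + C (α i) : MvPolynomial (Fin (n + 1)) F)) f) * w -
          aeval (fun i : Fin n => (X 0 * X i.succ + C (α i) : MvPolynomial (Fin (n + 1)) F)) f *
            pderiv 0 w) =
      truncDegreeOf 0 M (w * H))
    (hb : truncDegreeOf 0 1 w = rename Fin.succ b') (hb0 : b' ≠ 0)
    (hw : UABPComputes s w) (hbP : UABPComputes s b') (hH : UABPComputes S H)
    (hdeg : f.totalDegree ≤ M) (hs : 2 ≤ s) (hM : M + 1 ≤ s)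
    (hs' : 4 * S * s ^ 4 + 145 * s ^ 7 + 2 ≤ s') : UABPComputes (100 * s' ^ 5) f := by
  set P : MvPolynomial (Fin (n + 1)) F :=
    aeval (fun i : Fin n => (X 0 * X i.succ + C (α i) : MvPolynomial (Fin (n + 1)) F)) f with hP
  have hb0' : (rename Fin.succ b' : MvPolynomial (Fin (n + 1)) F) ≠ 0 := fun h0 =>
    hb0 (rename_injective _ (Fin.succ_injective n) (by rw [h0, map_zero]))
  have hP0 : truncDegreeOf 0 1 P = C (eval α f) := truncDegreeOf_one_aeval_phi f α
  -- §3: the congruence `b^{M+1} · Φ f ≡ Num`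
  have hcongr := truncDegreeOf_traceBack_step hW hb hb0' hP0
  -- programs
  have hbR : UABPComputes s (rename Fin.succ b' : MvPolynomial (Fin (n + 1)) F) :=
    hbP.rename Fin.succ
  have hp0 : UABPComputes s (C (eval α f) : MvPolynomial (Fin (n + 1)) F) :=
    ((UABPComputesLen.of_C (n := n + 1) (S := 2) le_rfl (eval α f)).uabpComputes).mono hs
  have hNum := UABPComputes.traceBackNum (0 : Fin (n + 1)) hw hH hp0 hbR hM hs
  have hden : UABPComputes (2 * s ^ 2) (b' ^ (M + 1)) := UABPComputes.traceBackDen hbP hM hs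
  -- the last step
  rw [← map_pow] at hcongr
  refine uabpComputes_of_phi_truncDegreeOf_eq α hNum hden (pow_ne_zero _ hb0) hcongr
    (Nat.lt_of_le_of_lt hdeg (Nat.lt_succ_self M)) ?_ ?_ ?_ ?_
  · have : 2 ≤ s ^ 7 := le_trans hs (Nat.le_self_pow (by norm_num) s)
    omega
  · have e1 : (M + 1) * ((4 * S * s ^ 2 + 145 * s ^ 5) * (M + 1)) ≤
        s * ((4 * S * s ^ 2 + 145 * s ^ 5) * s) :=
      Nat.mul_le_mul hM (Nat.mul_le_mul_left _ hM)
    have e2 : s * ((4 * S * s ^ 2 + 145 * s ^ 5) * s) = 4 * S * s ^ 4 + 145 * s ^ 7 := by ring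
    omega
  · have e1 : 2 * s ^ 2 ≤ 2 * s ^ 7 :=
      Nat.mul_le_mul_left 2 (Nat.pow_le_pow_right (by omega) (by norm_num))
    omega
  · have e1 : 2 * (M + 1) ≤ 2 * s ^ 7 :=
      le_trans (Nat.mul_le_mul_left 2 hM) (Nat.mul_le_mul_left 2 (Nat.le_self_pow (by norm_num) s))
    omega

end PhiStep

/-! ## §5 The general round (`j ≥ 1`): rational divisor, virtual fraction, `z = 0` value pair

At stage `j` of the trace-back the object `f_j` is not a polynomial but a `z`-adic expansion with
an `x`-denominator; here it is carried VIRTUALLY as a fraction `P/E` of polynomials (`E|_{z=0}`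
`z`-free and nonzero), never as a Lean object with a program: only its `z = 0` value (Claim 3.8,
an `F[x]`-fraction `Nw/ew`) and the NEXT stage's congruence enter. The divisor
`t = t_{k−j,j}` is a fraction `A/B` ("`t ∈ lim (ΠΣ/ΠΣ)(Σ∧Σ/Σ∧Σ) ⊆ (ΠΣ/ΠΣ)(ARO/ARO)`",
p0035 L925) with `A|_{z=0}, B|_{z=0}` `z`-free and nonzero (the case `v = 0`). -/

section Round

variable {σ : Type*} {S : Type*} [CommRing S] [DecidableEq σ]

omit [DecidableEq σ] in
/-- Products of `z`-free polynomials are `z`-free. [folklore] -/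
private theorem degreeOf_mul_eq_zero {i : σ} {c c' : MvPolynomial σ S} (hc : c.degreeOf i = 0)
    (hc' : c'.degreeOf i = 0) : (c * c').degreeOf i = 0 := by
  have h := degreeOf_mul_le i c c'
  rw [hc, hc', add_zero] at h
  exact Nat.le_zero.1 h

/-- **The first-round conversion** ("`f_{k−1}` has a `poly(s_{k−1})`-size ABP/ABP", p0035 L917–918,
read modulo `z^{M+1}`): if the virtual fraction `P/E` agrees with `A/B` modulo `z^{M+1}`
(`P · B ≡ A · E`), then with `β = B|_{z=0}` and the truncated inverse of `B`:
`β^{M+1} · P ≡ (A · Inv_M(B)) · E (mod z^{M+1})` — a congruence with a `z`-FREE left multiplier.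
[cite: DuttaDwivediSaxena2022, §3 proof of Thm. 3.2, Claim 3.7 (full version p0034 L906–913, p0035 L917–918)] -/
theorem truncDegreeOf_traceBack_top {i : σ} {M : ℕ} {P E A B β : MvPolynomial σ S}
    (h : truncDegreeOf i (M + 1) (P * B) = truncDegreeOf i (M + 1) (A * E))
    (hβ : truncDegreeOf i 1 B = β) :
    truncDegreeOf i (M + 1) (β ^ (M + 1) * P) =
      truncDegreeOf i (M + 1)
        ((A * ∑ j ∈ Finset.range (M + 1), β ^ j * (β - B) ^ (M - j)) * E) := by
  set Inv : MvPolynomial σ S := ∑ j ∈ Finset.range (M + 1), β ^ j * (β - B) ^ (M - j)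
    with hInv_def
  have h1 : truncDegreeOf i (M + 1) (B * Inv) = truncDegreeOf i (M + 1) (β ^ (M + 1)) :=
    truncDegreeOf_mul_truncInv hβ M
  have h2 : truncDegreeOf i (M + 1) (P * B * Inv) = truncDegreeOf i (M + 1) (A * E * Inv) :=
    truncDegreeOf_mul_congr h rfl
  have e1 : β ^ (M + 1) * P = P * β ^ (M + 1) := mul_comm _ _
  have e2 : P * (B * Inv) = P * B * Inv := (mul_assoc _ _ _).symm
  have e3 : A * E * Inv = A * Inv * E := by ring
  rw [e1, truncDegreeOf_mul_congr (rfl : truncDegreeOf i (M + 1) P = _) h1.symm, e2, h2, e3]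

variable {K : Type*} [Field K] [CharZero K]

/-- **DDS Claim 3.7, the general trace-back round, PROVED** (case `v = 0`). Stage-`j` data: the
virtual fraction `f_j = P/E`, the divisor `t_j = A/B`, the `z = 0` value
`(f_j/t_j)|_{z=0} = Nw/ew` (as the cross-multiplied identity `ew · (P B)|_{z=0} = Nw · (E A)|_{z=0}`,
`ew` `z`-free — Claim 3.8's export), and the NEXT stage
`f_{j+1} := ∂_z (f_j/t_j) = N′/E′`, `N′ = ∂_z(P B) · (E A) − P B · ∂_z(E A)`, `E′ = (E A)²`, known
modulo `z^M` with a `z`-free denominator: `den′ · N′ ≡ Num′ · E′ (mod z^M)`. Conclusion: `f_j` is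
known modulo `z^{M+1}` with a `z`-free denominator,
`(β^{M+1} b^{M+1} den′ ew) · P ≡ (A · R · Inv_M(B)) · E (mod z^{M+1})`, where `b = (E A)|_{z=0}`,
`β = B|_{z=0}`, `R = b^M · (den′ · Nw · b) + ∫_M ((ew · Num′ · E A) · Inv_M(E A))` — "`f/t =
f/t|_{z=0} + ∑ (C_i/i) z^i` … multiply by `t` and truncate", one stage up. `P` and `E` carry no
programs; everything on the right does.
[cite: DuttaDwivediSaxena2022, §3 proof of Thm. 3.2, Claim 3.7 (full version p0034 L897 – p0035 L931) and Claim 3.8 (p0035 L934 – p0036 L951)] -/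
theorem truncDegreeOf_traceBack_round {i : σ} {M : ℕ}
    {P E A B Num' den' Nw ew b β : MvPolynomial σ K}
    (hH : truncDegreeOf i M (den' * (pderiv i (P * B) * (E * A) - P * B * pderiv i (E * A))) =
      truncDegreeOf i M (Num' * (E * A) ^ 2))
    (hden' : den'.degreeOf i = 0) (hb : truncDegreeOf i 1 (E * A) = b) (hb0 : b ≠ 0)
    (hβ : truncDegreeOf i 1 B = β) (hew : ew.degreeOf i = 0)
    (hw0 : ew * truncDegreeOf i 1 (P * B) = Nw * b) :
    truncDegreeOf i (M + 1) (β ^ (M + 1) * b ^ (M + 1) * den' * ew * P) =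
      truncDegreeOf i (M + 1)
        ((A * (b ^ M * (den' * Nw * b) +
            integrateDegreeOf i M ((ew * Num' * (E * A)) *
              ∑ j ∈ Finset.range (M + 1), b ^ j * (b - E * A) ^ (M - j))) *
          ∑ j ∈ Finset.range (M + 1), β ^ j * (β - B) ^ (M - j)) * E) := by
  set w : MvPolynomial σ K := E * A with hw_def
  set InvW : MvPolynomial σ K := ∑ j ∈ Finset.range (M + 1), b ^ j * (b - w) ^ (M - j)
    with hInvW_def
  set InvB : MvPolynomial σ K := ∑ j ∈ Finset.range (M + 1), β ^ j * (β - B) ^ (M - j)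
    with hInvB_def
  set R : MvPolynomial σ K := b ^ M * (den' * Nw * b) + integrateDegreeOf i M ((ew * Num' * w) * InvW)
    with hR_def
  have hcz : (den' * ew).degreeOf i = 0 := degreeOf_mul_eq_zero hden' hew
  -- the cleared divide-and-derive identity for `P★ := den' · ew · (P B)` and `w = E A`
  have hW : truncDegreeOf i M (pderiv i (den' * ew * (P * B)) * w - den' * ew * (P * B) * pderiv i w) =
      truncDegreeOf i M (w * (ew * Num' * w)) := by
    have e1 : pderiv i (den' * ew * (P * B)) * w - den' * ew * (P * B) * pderiv i w =
        ew * (den' * (pderiv i (P * B) * (E * A) - P * B * pderiv i (E * A))) := by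
      rw [pderiv_mul, pderiv_eq_zero_of_degreeOf_eq_zero hcz, zero_mul, zero_add, hw_def]
      ring
    have e2 : w * (ew * Num' * w) = ew * (Num' * (E * A) ^ 2) := by rw [hw_def]; ring
    rw [e1, e2, truncDegreeOf_mul_of_degreeOf_eq_zero hew, truncDegreeOf_mul_of_degreeOf_eq_zero hew,
      hH]
  -- the `z = 0` value of `P★`
  have hP0 : truncDegreeOf i 1 (den' * ew * (P * B)) = den' * Nw * b := by
    rw [truncDegreeOf_mul_of_degreeOf_eq_zero hcz, mul_assoc, hw0, ← mul_assoc]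
  -- §3
  have hstep := truncDegreeOf_traceBack_step hW hb hb0 hP0
  -- kill `B` with its truncated inverse
  have h1 : truncDegreeOf i (M + 1) (B * InvB) = truncDegreeOf i (M + 1) (β ^ (M + 1)) :=
    truncDegreeOf_mul_truncInv hβ M
  have h2 : truncDegreeOf i (M + 1) (b ^ (M + 1) * (den' * ew * (P * B)) * InvB) =
      truncDegreeOf i (M + 1) (w * R * InvB) := truncDegreeOf_mul_congr hstep rfl
  have e3 : b ^ (M + 1) * (den' * ew * (P * B)) * InvB =
      b ^ (M + 1) * den' * ew * P * (B * InvB) := by ring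
  have h3 : truncDegreeOf i (M + 1) (b ^ (M + 1) * den' * ew * P * (B * InvB)) =
      truncDegreeOf i (M + 1) (b ^ (M + 1) * den' * ew * P * β ^ (M + 1)) :=
    truncDegreeOf_mul_congr rfl h1
  have e4 : b ^ (M + 1) * den' * ew * P * β ^ (M + 1) = β ^ (M + 1) * b ^ (M + 1) * den' * ew * P := by
    ring
  have e5 : w * R * InvB = A * R * InvB * E := by rw [hw_def]; ring
  rw [e3, h3, e4, e5] at h2
  exact h2

end Round

/-! ### §5b ABP programs for the general round -/

section RoundPrograms

variable {K : Type*} [Field K] {m : ℕ}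

/-- **Programs for the round's numerator core** `R = b^M · p₀ + ∫_M (H · Inv_M(w))` (no outer
factor): with programs for `w, b, p₀` within `s`, for `H` within `S`, `M + 1 ≤ s`, `2 ≤ s`,
`R` has a program within `4 · S · s^2 + 144 · s^5`.
[cite: DuttaDwivediSaxena2022, §3 proof of Thm. 3.2, Claim 3.7 and "Size blowup" (full version p0035 L923–931, p0036 L952–958)] -/
theorem UABPComputes.traceBackCore (i : Fin m) {s S M : ℕ} {w H p₀ b : MvPolynomial (Fin m) K}
    (hw : UABPComputes s w) (hH : UABPComputes S H) (hp : UABPComputes s p₀)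
    (hb : UABPComputes s b) (hM : M + 1 ≤ s) (hs : 2 ≤ s) :
    UABPComputes (4 * S * s ^ 2 + 144 * s ^ 5)
      (b ^ M * p₀ + Literature.RingTheory.MvPolynomial.integrateDegreeOf i M
        (H * ∑ j ∈ Finset.range (M + 1), b ^ j * (b - w) ^ (M - j))) := by
  have hInv := UABPComputes.truncInv hw hb hM hs
  have h1 := ((hH.mul hInv).integrateDegreeOf i M)
  have h2 : UABPComputes (2 + M * s + s) (b ^ M * p₀) := (hb.pow M).mul hp
  refine (h2.add h1).mono ?_
  have hMs : M ≤ s := by omega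
  have e1 : M * s ≤ s * s := Nat.mul_le_mul_right s hMs
  have e2 : M * (2 + (S + 33 * s ^ 3) * M) ≤ s * (2 + (S + 33 * s ^ 3) * s) :=
    Nat.mul_le_mul hMs (Nat.add_le_add_left (Nat.mul_le_mul_left _ hMs) 2)
  have e3 : s * (2 + (S + 33 * s ^ 3) * s) = 2 * s + S * (s * s) + 33 * s ^ 5 := by ring
  have e4 : 4 * S * s ^ 2 = 4 * (S * (s * s)) := by ring
  have e5 : 4 * (s * s) + 12 * s + 18 ≤ 12 * s ^ 5 := by
    have h4 : 4 ≤ s * s := Nat.mul_le_mul hs hs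
    have ha : 12 * s ≤ 6 * (s * s) := by nlinarith
    have hb : 18 ≤ 5 * (s * s) := by omega
    have hc : 8 * (s * s) ≤ s ^ 5 := by
      calc 8 * (s * s) = 2 * 2 * 2 * (s * s) := by ring
        _ ≤ s * s * s * (s * s) := Nat.mul_le_mul_right _ (Nat.mul_le_mul (Nat.mul_le_mul hs hs) hs)
        _ = s ^ 5 := by ring
    omega
  omega

/-- **Programs for the general round's numerator** `Num_j = A · R · Inv_M(B)`: with programs for
`A, B, w = E·A, b, β, p₀` within `s`, for `H` within `S`, `M + 1 ≤ s`, `2 ≤ s`, the numerator has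
a program within `s'` for every `s' ≥ 4 · S · s^2 + 178 · s^5`.
[cite: DuttaDwivediSaxena2022, §3 proof of Thm. 3.2, Claim 3.7 and "Size blowup" (full version p0035 L923–931, p0036 L952–958)] -/
theorem UABPComputes.traceBackRoundNum (i : Fin m) {s S s' M : ℕ}
    {w A B H p₀ b β : MvPolynomial (Fin m) K}
    (hw : UABPComputes s w) (hA : UABPComputes s A) (hB : UABPComputes s B)
    (hH : UABPComputes S H) (hp : UABPComputes s p₀) (hb : UABPComputes s b)
    (hβ : UABPComputes s β) (hM : M + 1 ≤ s) (hs : 2 ≤ s)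
    (hs' : 4 * S * s ^ 2 + 178 * s ^ 5 ≤ s') :
    UABPComputes s'
      (A * (b ^ M * p₀ + Literature.RingTheory.MvPolynomial.integrateDegreeOf i M
          (H * ∑ j ∈ Finset.range (M + 1), b ^ j * (b - w) ^ (M - j))) *
        ∑ j ∈ Finset.range (M + 1), β ^ j * (β - B) ^ (M - j)) := by
  have hR := UABPComputes.traceBackCore i hw hH hp hb hM hs
  have hInvB := UABPComputes.truncInv hB hβ hM hs
  refine ((hA.mul hR).mul hInvB).mono (le_trans ?_ hs')
  have e1 : s ≤ s ^ 5 := Nat.le_self_pow (by norm_num) s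
  have e2 : s ^ 3 ≤ s ^ 5 := Nat.pow_le_pow_right (by omega) (by norm_num)
  omega

/-- **Programs for the general round's denominator** `den_j = β^{M+1} · b^{M+1} · den′ · ew` (all
`z`-free): within `s'` for every `s' ≥ 10 · s^4` when the four factors have programs within `s`,
`M + 1 ≤ s`, `2 ≤ s`.
[cite: DuttaDwivediSaxena2022, §3 proof of Thm. 3.2, Claim 3.7 and "Size blowup" (full version p0035 L930–931, p0036 L952–958)] -/
theorem UABPComputes.traceBackRoundDen {s s' M : ℕ} {β b den' ew : MvPolynomial (Fin m) K}
    (hβ : UABPComputes s β) (hb : UABPComputes s b) (hden' : UABPComputes s den')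
    (hew : UABPComputes s ew) (hM : M + 1 ≤ s) (hs : 2 ≤ s) (hs' : 10 * s ^ 4 ≤ s') :
    UABPComputes s' (β ^ (M + 1) * b ^ (M + 1) * den' * ew) := by
  have h1 := UABPComputes.traceBackDen hβ hM hs
  have h2 := UABPComputes.traceBackDen hb hM hs
  refine ((((h1.mul h2).mul hden').mul hew)).mono (le_trans ?_ hs')
  have e1 : s ≤ s ^ 4 := Nat.le_self_pow (by norm_num) s
  have e2 : s ^ 2 ≤ s ^ 4 := Nat.pow_le_pow_right (by omega) (by norm_num)
  omega

end RoundPrograms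

end DDS2021

end Literature.Computability.AlgebraicComplexity
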